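import Literature.AlgebraicGeometry.Resolution.MvPowerSeriesChainRule
import Literature.RingTheory.MvPowerSeries.MaximalIdealPow
import Mathlib.FieldTheory.Perfect
import Mathlib.Algebra.CharP.Algebra
import HarnessLib

/-!
# Derivations of `K⟦X₁, …, Xₙ⟧`: the structure theorem `D = Σᵢ D(Xᵢ) ∂ᵢ` and the Jacobian ideal

OURS (campaign `res-hironaka`, rung L, slot W4.1, chain W4.1 — infrastructure for the valuation-run
dictionary of crux `FrobeniusClosing.Steer`, stmt-16345; replaces the role of no printed item; NOT a
statement of the manuscript under review). Builds on `Literature/…/PowerSeriesRegularLocal.lean` (the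
derivation `MvPowerSeries.pderiv i = ∂/∂Xᵢ` of `K⟦X⟧`) and `MvPowerSeriesChainRule.lean`. For a
FIELD `K` and finitely many variables `σ`, every derivation `D : K⟦X⟧ → K⟦X⟧` (over any ring of
scalars) which kills the constants `C c` is the combination `Σᵢ D(Xᵢ) · ∂ᵢ` of the partial
derivatives — the formal-power-series case of the freeness of the module of derivations on
`∂/∂Xᵢ` (Matsumura, *Commutative Ring Theory*, §30, for rings of formal power series; EGA 0_IV
20.1). Proof: an additive map with the Leibniz rule vanishing on the `Xᵢ` and on `K` vanishes on
polynomials, maps `𝔪 ^ (n+1)` into `𝔪 ^ n`, and `K⟦X⟧` is `𝔪`-adically separated with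
`f ≡ truncTotal N f (mod 𝔪 ^ N)` (`Literature.RingTheory.MvPowerSeries.Jets`). Everything PROVED;
no definitions.

* `leibnizMap_apply_eq_zero` — an additive Leibniz map vanishing on `K` and on every `Xᵢ` is zero.
* `derivation_apply_eq_sum_mul_pderiv` — `D f = Σᵢ D (X i) * ∂ᵢ f` for every derivation `D` (any
  scalars) with `D (C c) = 0`; `derivation_apply_eq_sum_mul_pderiv'` — the same for `K`-derivations.
* `derivation_int_apply_C_eq_zero` — over a PERFECT field of characteristic `p`, every
  `ℤ`-derivation kills the constants (`c = b ^ p`); hence `derivation_int_apply_eq_sum_mul_pderiv`.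
* `derivation_apply_mem_span_pderiv`, `span_derivation_int_apply_eq_span_pderiv` — the JACOBIAN
  IDEAL: `⟨δ f | δ ∈ Der_ℤ(K⟦X⟧)⟩ = ⟨∂₁ f, …, ∂ₙ f⟩` for `K` perfect.
* `finite_quotient_of_maximalIdeal_pow_le` — an ideal containing a power of `𝔪` has
  finite-dimensional quotient (so an `𝔪`-primary Jacobian ideal gives a finite Milnor-type algebra).

Consumers: the valuation-run dictionary of crux `FrobeniusClosing.Steer` (chain W4.1: the isolation
predicate `IsolAt` of both registered cuts, stated with `Der_ℤ`, read in Cohen coordinates as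
finiteness of `K⟦X⟧ ⧸ ⟨∂ᵢ f⟩` = the typed `Isol` of `IsolatedForcedTermination`). Cut-independent;
no `Theses.*` / `Cruxes.*` import (chain build rule).

## References

* H. Matsumura, *Commutative Ring Theory*, CUP 1986, §25 and §30 (derivations of power series rings).
-/

noncomputable section

-- layout-mandated namespace `Summit.<Summit>.<Problem>.…` with Summit = Problem (single-conjunct summit)
set_option linter.dupNamespace false

open MvPowerSeries IsLocalRing
open Literature.RingTheory.MvPowerSeries.Jets
open Literature.AlgebraicGeometry.Resolution

namespace Summit.ResolutionOfSingularities.ResolutionOfSingularities.Theorems.SwitchingDichotomy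

variable {σ : Type*} [Fintype σ] {K : Type*} [Field K]

/-! ### An additive Leibniz map vanishing on `K` and on the variables vanishes -/

omit [Fintype σ] in
/-- An additive map `E : K⟦X⟧ → K⟦X⟧` with the Leibniz rule which vanishes on the constants and on
every variable vanishes on (the images of) all polynomials. [folklore] -/
theorem leibnizMap_apply_coe_eq_zero (E : MvPowerSeries σ K →+ MvPowerSeries σ K)
    (hmul : ∀ f g, E (f * g) = f * E g + g * E f) (hC : ∀ c : K, E (C c) = 0)
    (hX : ∀ i : σ, E (X i) = 0) (q : MvPolynomial σ K) : E (q : MvPowerSeries σ K) = 0 := by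
  induction q using MvPolynomial.induction_on with
  | C c => rw [MvPolynomial.coe_C]; exact hC c
  | add p q hp hq => rw [MvPolynomial.coe_add, map_add, hp, hq, add_zero]
  | mul_X p i hp => rw [MvPolynomial.coe_mul, MvPolynomial.coe_X, hmul, hX, hp, mul_zero, mul_zero,
      add_zero]

omit [Fintype σ] in
/-- An additive Leibniz map sends `𝔪 ^ (n + 1)` into `𝔪 ^ n`. [folklore] -/
theorem leibnizMap_apply_mem_pow (E : MvPowerSeries σ K →+ MvPowerSeries σ K)
    (hmul : ∀ f g, E (f * g) = f * E g + g * E f) (n : ℕ) {a : MvPowerSeries σ K}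
    (ha : a ∈ maximalIdeal (MvPowerSeries σ K) ^ (n + 1)) :
    E a ∈ maximalIdeal (MvPowerSeries σ K) ^ n := by
  induction n generalizing a with
  | zero => rw [pow_zero, Ideal.one_eq_top]; exact Submodule.mem_top
  | succ n ih =>
    rw [pow_succ] at ha
    refine Submodule.mul_induction_on ha (fun x hx y hy => ?_) (fun x y hx hy => ?_)
    · rw [hmul]
      refine Ideal.add_mem _ (Ideal.mul_mem_right _ _ hx) ?_
      have h1 := Ideal.mul_mem_mul (ih hx) hy
      rwa [mul_comm (E x) y, ← pow_succ] at h1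
    · rw [map_add]
      exact Ideal.add_mem _ hx hy

/-- **An additive Leibniz map of `K⟦X⟧` vanishing on `K` and on every `Xᵢ` is zero** (`σ` finite):
it vanishes on polynomials, lowers the `𝔪`-adic order by at most one, and `K⟦X⟧` is `𝔪`-adically
separated with polynomial jets. [folklore] -/
theorem leibnizMap_apply_eq_zero (E : MvPowerSeries σ K →+ MvPowerSeries σ K)
    (hmul : ∀ f g, E (f * g) = f * E g + g * E f) (hC : ∀ c : K, E (C c) = 0)
    (hX : ∀ i : σ, E (X i) = 0) (f : MvPowerSeries σ K) : E f = 0 := by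
  ext e
  rw [map_zero]
  set N := e.degree + 1 with hN
  have hsplit : f = ↑(truncTotal (N + 1) f) + (f - ↑(truncTotal (N + 1) f)) := by ring
  have hr : E (f - ↑(truncTotal (N + 1) f)) ∈ maximalIdeal (MvPowerSeries σ K) ^ N :=
    leibnizMap_apply_mem_pow E hmul N (sub_coe_truncTotal_mem_maximalIdeal_pow (N + 1) f)
  rw [hsplit, map_add, leibnizMap_apply_coe_eq_zero E hmul hC hX, zero_add]
  exact coeff_eq_zero_of_mem_maximalIdeal_pow hr (Nat.lt_succ_self _)

/-! ### The structure theorem -/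

/-- **`D = Σᵢ D(Xᵢ) ∂ᵢ` on `K⟦X₁, …, Xₙ⟧`.** For a derivation `D` of `K⟦X⟧` into itself, over any
ring of scalars, which kills the constants `C c`: `D f = Σᵢ D (X i) * ∂ᵢ f`. (Apply
`leibnizMap_apply_eq_zero` to `D - Σᵢ D(Xᵢ) ∂ᵢ`.) [folklore] -/
theorem derivation_apply_eq_sum_mul_pderiv {S : Type*} [CommSemiring S]
    [Algebra S (MvPowerSeries σ K)] (D : Derivation S (MvPowerSeries σ K) (MvPowerSeries σ K))
    (hC : ∀ c : K, D (C c) = 0) (f : MvPowerSeries σ K) :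
    D f = ∑ i, D (X i) * MvPowerSeries.pderiv i f := by
  classical
  -- the difference `E := D - Σᵢ D(Xᵢ) ∂ᵢ` as an additive map
  let E : MvPowerSeries σ K →+ MvPowerSeries σ K :=
    D.toLinearMap.toAddMonoidHom -
      ∑ i, (AddMonoidHom.mulLeft (D (X i))).comp (MvPowerSeries.pderiv (R := K) i).toLinearMap.toAddMonoidHom
  have hE : ∀ g, E g = D g - ∑ i, D (X i) * MvPowerSeries.pderiv i g := fun g => by
    simp only [E, AddMonoidHom.sub_apply, AddMonoidHom.finsetSum_apply, AddMonoidHom.coe_comp,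
      Function.comp_apply, AddMonoidHom.coe_mulLeft, LinearMap.toAddMonoidHom_coe,
      Derivation.coeFn_coe]
  have hmul : ∀ f g, E (f * g) = f * E g + g * E f := fun f g => by
    rw [hE, hE, hE, Derivation.leibniz, smul_eq_mul, smul_eq_mul]
    simp only [Derivation.leibniz, smul_eq_mul, mul_add, Finset.sum_add_distrib, mul_sub,
      Finset.mul_sum]
    ring_nf
  have hCE : ∀ c : K, E (C c) = 0 := fun c => by
    rw [hE, hC]
    simp only [MvPowerSeries.pderiv_C, mul_zero, Finset.sum_const_zero, sub_zero]
  have hXE : ∀ i : σ, E (X i) = 0 := fun i => by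
    rw [hE]
    simp only [MvPowerSeries.pderiv_X, mul_ite, mul_one, mul_zero]
    rw [Finset.sum_ite_eq, if_pos (Finset.mem_univ i), sub_self]
  have h := leibnizMap_apply_eq_zero E hmul hCE hXE f
  rw [hE, sub_eq_zero] at h
  exact h

/-- **`D = Σᵢ D(Xᵢ) ∂ᵢ` for `K`-derivations of `K⟦X⟧`** (constants are killed automatically).
[folklore] -/
theorem derivation_apply_eq_sum_mul_pderiv' (D : Derivation K (MvPowerSeries σ K) (MvPowerSeries σ K))
    (f : MvPowerSeries σ K) : D f = ∑ i, D (X i) * MvPowerSeries.pderiv i f :=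
  derivation_apply_eq_sum_mul_pderiv D (fun c => by
    rw [MvPowerSeries.c_eq_algebraMap]; exact D.map_algebraMap c) f

/-! ### `ℤ`-derivations over a perfect field of characteristic `p` -/

omit [Fintype σ] in
/-- Over a PERFECT field `K` of characteristic `p`, every `ℤ`-derivation of `K⟦X⟧` kills the
constants: `c = b ^ p` and `D (C b ^ p) = p • (C b) ^ (p-1) • D (C b) = 0`. [folklore] -/
theorem derivation_int_apply_C_eq_zero (p : ℕ) [Fact p.Prime] [CharP K p] [PerfectField K]
    (D : Derivation ℤ (MvPowerSeries σ K) (MvPowerSeries σ K)) (c : K) : D (C c) = 0 := by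
  haveI : CharP (MvPowerSeries σ K) p :=
    charP_of_injective_algebraMap (algebraMap K (MvPowerSeries σ K)).injective p
  obtain ⟨b, rfl⟩ := surjective_frobenius K p c
  rw [frobenius_def, map_pow, Derivation.leibniz_pow, smul_eq_mul, nsmul_eq_mul, CharP.cast_eq_zero,
    zero_mul]

/-- **`D = Σᵢ D(Xᵢ) ∂ᵢ` for `ℤ`-derivations of `K⟦X⟧`, `K` perfect of characteristic `p`.**
[folklore] -/
theorem derivation_int_apply_eq_sum_mul_pderiv (p : ℕ) [Fact p.Prime] [CharP K p] [PerfectField K]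
    (D : Derivation ℤ (MvPowerSeries σ K) (MvPowerSeries σ K)) (f : MvPowerSeries σ K) :
    D f = ∑ i, D (X i) * MvPowerSeries.pderiv i f :=
  derivation_apply_eq_sum_mul_pderiv D (derivation_int_apply_C_eq_zero p D) f

/-! ### The Jacobian ideal -/

/-- For a derivation `D` killing the constants, `D f` lies in the Jacobian ideal `⟨∂₁ f, …, ∂ₙ f⟩`.
[folklore] -/
theorem derivation_apply_mem_span_pderiv {S : Type*} [CommSemiring S]
    [Algebra S (MvPowerSeries σ K)] (D : Derivation S (MvPowerSeries σ K) (MvPowerSeries σ K))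
    (hC : ∀ c : K, D (C c) = 0) (f : MvPowerSeries σ K) :
    D f ∈ Ideal.span (Set.range fun i => MvPowerSeries.pderiv i f) := by
  rw [derivation_apply_eq_sum_mul_pderiv D hC f]
  exact Ideal.sum_mem _ fun i _ => Ideal.mul_mem_left _ _ (Ideal.subset_span ⟨i, rfl⟩)

/-- **The Jacobian ideal via `ℤ`-derivations**, `K` perfect of characteristic `p`:
`⟨δ f | δ ∈ Der_ℤ(K⟦X⟧, K⟦X⟧)⟩ = ⟨∂₁ f, …, ∂ₙ f⟩` (`≤`: structure theorem; `≥`: each `∂ᵢ` is a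
`ℤ`-derivation). [folklore] -/
theorem span_derivation_int_apply_eq_span_pderiv (p : ℕ) [Fact p.Prime] [CharP K p] [PerfectField K]
    (f : MvPowerSeries σ K) :
    Ideal.span (Set.range fun D : Derivation ℤ (MvPowerSeries σ K) (MvPowerSeries σ K) => D f) =
      Ideal.span (Set.range fun i => MvPowerSeries.pderiv i f) := by
  apply le_antisymm
  · rw [Ideal.span_le]
    rintro _ ⟨D, rfl⟩
    exact derivation_apply_mem_span_pderiv D (derivation_int_apply_C_eq_zero p D) f
  · rw [Ideal.span_le]
    rintro _ ⟨i, rfl⟩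
    exact Ideal.subset_span ⟨(MvPowerSeries.pderiv (R := K) i).restrictScalars ℤ, rfl⟩

/-- If a power of the maximal ideal lies in the ideal generated by the values `δ f` of the
`ℤ`-derivations (`K` perfect of characteristic `p`), then it lies in the Jacobian ideal
`⟨∂₁ f, …, ∂ₙ f⟩`. [folklore] -/
theorem maximalIdeal_pow_le_span_pderiv_of_le_span_derivation (p : ℕ) [Fact p.Prime] [CharP K p]
    [PerfectField K] {f : MvPowerSeries σ K} {N : ℕ}
    (h : maximalIdeal (MvPowerSeries σ K) ^ N ≤
      Ideal.span (Set.range fun D : Derivation ℤ (MvPowerSeries σ K) (MvPowerSeries σ K) => D f)) :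
    maximalIdeal (MvPowerSeries σ K) ^ N ≤ Ideal.span (Set.range fun i => MvPowerSeries.pderiv i f) := by
  rw [← span_derivation_int_apply_eq_span_pderiv p f]
  exact h

/-! ### Finiteness of quotients by `𝔪`-primary ideals -/

/-- An ideal of `K⟦X₁, …, Xₙ⟧` containing a power of the maximal ideal has a quotient that is
finite-dimensional over `K` (it is a quotient of the jet algebra `K⟦X⟧ ⧸ 𝔪 ^ N`). [folklore] -/
theorem finite_quotient_of_maximalIdeal_pow_le {J : Ideal (MvPowerSeries σ K)} {N : ℕ}
    (h : maximalIdeal (MvPowerSeries σ K) ^ N ≤ J) : Module.Finite K (MvPowerSeries σ K ⧸ J) := by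
  haveI := finite_quotient_maximalIdeal_pow (σ := σ) (K := K) N
  exact Module.Finite.of_surjective (Ideal.Quotient.factorₐ K h).toLinearMap
    (Ideal.Quotient.factor_surjective h)

/-- **Finite Milnor-type algebra from an `𝔪`-primary Jacobian ideal** (`K` perfect of characteristic
`p`): if `𝔪 ^ N ≤ ⟨δ f | δ ∈ Der_ℤ⟩` then `K⟦X⟧ ⧸ ⟨∂₁ f, …, ∂ₙ f⟩` is finite-dimensional over `K`.
[folklore] -/
theorem finite_quotient_span_pderiv_of_le_span_derivation (p : ℕ) [Fact p.Prime] [CharP K p]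
    [PerfectField K] {f : MvPowerSeries σ K} {N : ℕ}
    (h : maximalIdeal (MvPowerSeries σ K) ^ N ≤
      Ideal.span (Set.range fun D : Derivation ℤ (MvPowerSeries σ K) (MvPowerSeries σ K) => D f)) :
    Module.Finite K (MvPowerSeries σ K ⧸ Ideal.span (Set.range fun i => MvPowerSeries.pderiv i f)) :=
  finite_quotient_of_maximalIdeal_pow_le (maximalIdeal_pow_le_span_pderiv_of_le_span_derivation p h)

end Summit.ResolutionOfSingularities.ResolutionOfSingularities.Theorems.SwitchingDichotomy

end
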